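import Summits.Ventures.LatticeQCDFlow.TrivializingMaps.FlowAutocorrelationCeilingAnyGroup

/-!
HONEST FRAMING: exact (Metropolis-corrected) sampling algorithms for lattice gauge theory; figures
of merit are autocorrelation/cost numbers at stated couplings and volumes; no continuum-physics
claim.

# FlowTauIntFloorAnyGroup — THE INTEGRATED AUTOCORRELATION TIME ITSELF: `τ_int(g) ≥ E_β[g²]/(B²·acc) − ½`
# FOR EVERY BOUNDED OBSERVABLE OF AN EXACT FLOW SAMPLER OF THE WILSON MEASURE (EVERY COMPACT GAUGE GROUP,
# EVERY COUPLING), TWO-SIDED `E_β[g²]/(B²·acc) − ½ ≤ τ_int(g) ≤ sup(p_β/q) − ½` FOR A COVERING MODEL — IN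
# PARTICULAR FOR EVERY CONTINUOUS FLOW (lean-2 GEN-13, ours)

Venture-side (OURS).  Cell `lqcd-flow` (pub-lqcd), unit `pub-lqcd-lean-2-g13`, 2026-08-23.  GEN-12 (chapter B)
bounded every LAG of the stationary autocorrelation function of an exact flow sampler (independence Metropolis
with the flow's output law `q·D[U]` as proposal) of the Wilson measure `μ_β`: `ρ_g(n) ≥ (1 − B²·acc/E_β[g²])ⁿ`
(`FlowAutocorrelationFloorAnyGroup`), the Γ-windows `τ_W ≥ ½ + W·θ^W` (`FlowTauIntWindowFloor`) and, for a model
COVERING the target (`p_β ≤ C'·q`), the ceiling `τ_int ≤ C' − ½` (`FlowAutocorrelationCeilingAnyGroup`), leaving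
"`τ_int` itself on the floor side (summability is a hypothesis)" NOT CLAIMED.  This file closes that item: the
cell's figure of merit `Scoring.tauInt` of every bounded observable obeys the RECIPROCITY LAW
`acc · (τ_int(g) + ½) ≥ E_β[g²]/B²` whenever the autocorrelation series is summable — automatically so for a
covering model, in particular for EVERY CONTINUOUS POSITIVE MODEL DENSITY on the (compact) configuration space.

## What is proved

* §1 (general `(X, μ)`; target weight `w > 0`, model density `q > 0`, `∫ q = 1`, `|g| ≤ B` measurable,
  `E = ∫ g² w > 0`, `A = ∫∫ min(w(x)q(y), w(y)q(x))` the symmetrised accepted flow `= Z·acc`):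
  `one_div_sub_half_le` (the arithmetic of `x ↦ ½ + x/(1−x) = 1/(1−x) − ½`); `acceptFlow_pos` (`A > 0`);
  **`imhOp_tauInt_ge_invAcceptance`** — if the autocorrelation series of `g` along the exact chain is
  summable then `E/(B²·A) − ½ ≤ τ_int(ρ_g)` (row 2's rejection floor `τ_int ≥ ½ + r_g/(1 − r_g)` composed with
  GEN-12's `r_g ≥ 1 − B²A/E`); **`imhOp_tauInt_twoSided`** — under a weight bound `w ≤ C·q` and `∫ g w = 0`
  summability is automatic (row 2) and `E/(B²A) − ½ ≤ τ_int(ρ_g) ≤ C/Z − ½`.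
* §2 (the Wilson measure of every compact `G`, continuous `ρ`, every real `β`; `p_β = e^{−βS_W}/∫e^{−βS_W}dD[U]`;
  measurable model density `q > 0`, `∫ q dD[U] = 1`; bounded measurable `g`, `E_β[g²] > 0`;
  `acc = ∫∫ min(p_β(U)q(V), p_β(V)q(U)) dD dD` the stationary acceptance of GEN-11's `FlowAcceptanceCeiling`):
  `wilson_flowAcc_pos`; **`wilson_flow_tauInt_ge`** — summable series ⇒ `E_β[g²]/(B²·acc) − ½ ≤ τ_int(ρ_g)`;
  **`wilson_flow_tauInt_twoSided`** — covering model `p_β ≤ C'·q`, centred `g`: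
  `E_β[g²]/(B²·acc) − ½ ≤ τ_int(ρ_g) ≤ C' − ½`; **`wilson_flow_tauInt_ge_of_continuous`** — for every
  CONTINUOUS positive model density the floor holds with no further hypothesis (a covering constant exists by
  compactness of `G^E`); the explicit all-couplings forms (GEN-11's acceptance ceiling inside the
  reciprocity law: `τ_int` EXPONENTIAL IN THE VOLUME, the plaquette included) are the companion file
  `TrivializingMaps/FlowTauIntAllCouplings.lean`.

Reading (no numerics implied): for the exact flow sampler in equilibrium the integrated autocorrelation time of
an observable and the acceptance rate are RECIPROCAL — `τ_int(g) + ½ ≥ (E_β[g²]/B²)/acc`; e.g. a sector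
indicator `g = 1_Ω − μ_β(Ω)` has `τ_int ≥ μ_β(Ω)(1 − μ_β(Ω))/acc − ½`.  With chapter B's ceiling this is the
two-sided law `E_β[g²]/(B²·acc) − ½ ≤ τ_int(g) ≤ sup(p_β/q) − ½` for every model that covers the target
(every continuous flow on a compact group does, with some constant); with GEN-11's acceptance ceiling it
becomes the cost statement of the companion file (`τ_int ≥ E_β[g²]·e^{c(β)·volume}/(B²C) − ½` for a model
density within a factor `C` of the Haar prior).  NOT CLAIMED: anything about a specific
architecture, its constants `C, C'`, or training cost; unbounded observables; non-summable series (there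
`Scoring.tauInt`'s `tsum` convention returns `½` and row 2's dichotomy `forall_summable_autocov_iff` applies);
the continuum.  Literature grade (cell rule): KNOWN MECHANISM (independence sampler: rejection ⇒ geometric
persistence, `τ` controlled by the importance weights — Liu 1996; Mengersen–Tweedie 1996; Madras–Sokal 1988 for
`τ_int`), NEW TYPING (every compact gauge group, every coupling, explicit, in the cell's `Scoring` vocabulary);
nothing cited as a fact.
-/

noncomputable section

open MeasureTheory ProbabilityTheory Real Set Filter
open Literature.MathematicalPhysics.QuantumFieldTheory
open Literature.MathematicalPhysics.QuantumFieldTheory.Luscher2010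
open Summit.Ventures.LatticeQCDFlow.Exactness
open Summit.Ventures.LatticeQCDFlow.Scaling
open Summit.Ventures.LatticeQCDFlow.Scoring

namespace Summit.Ventures.LatticeQCDFlow.TrivializingMaps

/-! ## §1 General state space -/

section General

variable {X : Type*} [MeasurableSpace X] {μ : Measure X} [SFinite μ] {w q : X → ℝ}

/-- The arithmetic of the rejection floor: if `x < 1` and `1 − x ≤ ε` then `1/ε − ½ ≤ ½ + x/(1 − x)`
(`½ + x/(1−x) = 1/(1−x) − ½`). [folklore] -/
theorem one_div_sub_half_le {x ε : ℝ} (hx1 : x < 1) (h : 1 - x ≤ ε) :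
    1 / ε - 1 / 2 ≤ 1 / 2 + x / (1 - x) := by
  have h1x : 0 < 1 - x := sub_pos.2 hx1
  have hε : 1 / ε ≤ 1 / (1 - x) := one_div_le_one_div_of_le h1x h
  have e : 1 / 2 + x / (1 - x) = 1 / (1 - x) - 1 / 2 := by
    field_simp
    ring
  rw [e]
  linarith

omit [SFinite μ] in
/-- A positive measurable `q` with `∫ q dμ = 1` is integrable and `μ ≠ 0`. [folklore] -/
theorem integrable_and_ne_zero_of_integral_eq_one (hq1 : ∫ t, q t ∂μ = 1) :
    Integrable q μ ∧ μ ≠ 0 := by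
  refine ⟨?_, fun h => ?_⟩
  · by_contra h
    rw [integral_undef h] at hq1
    exact zero_ne_one hq1
  · rw [h, integral_zero_measure] at hq1
    exact zero_ne_one hq1

/-- **The symmetrised accepted flow is positive**: `0 < ∫∫ min(w(x)q(y), w(y)q(x)) d(μ⊗μ)` for positive
integrable `w, q` with `∫ q = 1`. [folklore] -/
theorem acceptFlow_pos (hw0 : ∀ t, 0 < w t) (hwm : Measurable w) (hwi : Integrable w μ)
    (hq0 : ∀ t, 0 < q t) (hqm : Measurable q) (hq1 : ∫ t, q t ∂μ = 1) :
    0 < ∫ z, min (w z.1 * q z.2) (w z.2 * q z.1) ∂(μ.prod μ) := by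
  obtain ⟨hqi, hμ⟩ := integrable_and_ne_zero_of_integral_eq_one (μ := μ) hq1
  have hF : Integrable (fun z : X × X => min (w z.1 * q z.2) (w z.2 * q z.1)) (μ.prod μ) := by
    refine Integrable.mono' (hwi.mul_prod hqi)
      (((hwm.comp measurable_fst).mul (hqm.comp measurable_snd)).min
        ((hwm.comp measurable_snd).mul (hqm.comp measurable_fst))).aestronglyMeasurable
      (Eventually.of_forall fun z => ?_)
    rw [Real.norm_eq_abs, abs_of_nonneg (le_min (mul_nonneg (hw0 _).le (hq0 _).le)
      (mul_nonneg (hw0 _).le (hq0 _).le))]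
    exact min_le_left _ _
  rw [integral_pos_iff_support_of_nonneg_ae (Eventually.of_forall fun z =>
    le_min (mul_nonneg (hw0 _).le (hq0 _).le) (mul_nonneg (hw0 _).le (hq0 _).le)) hF]
  have hsupp : Function.support (fun z : X × X => min (w z.1 * q z.2) (w z.2 * q z.1)) = univ := by
    refine eq_univ_of_forall fun z => ?_
    rw [Function.mem_support]
    exact (lt_min (mul_pos (hw0 _) (hq0 _)) (mul_pos (hw0 _) (hq0 _))).ne'
  rw [hsupp, ← Set.univ_prod_univ, Measure.prod_prod]
  have hu : 0 < μ univ := pos_iff_ne_zero.2 (Measure.measure_univ_ne_zero.2 hμ)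
  exact ENNReal.mul_pos hu.ne' hu.ne'

/-- **`τ_int ≥ E/(B²·A) − ½` — THE INTEGRATED AUTOCORRELATION TIME IS AT LEAST THE INVERSE ACCEPTANCE.**
`w, q > 0` measurable integrable, `∫ q = 1`; `g` measurable, `|g| ≤ B`, `E = ∫ g² w > 0`; `K = imhOp μ w q`;
`A = ∫∫ min(w(x)q(y), w(y)q(x))` (so `A/∫w` is the stationary acceptance rate).  If the autocorrelation series
`n ↦ ∫ g(Kⁿ⁺¹g)w/E` is summable, then `E/(B²A) − ½ ≤ τ_int`. [ours] -/
theorem imhOp_tauInt_ge_invAcceptance (hw0 : ∀ t, 0 < w t) (hwm : Measurable w) (hwi : Integrable w μ)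
    (hq0 : ∀ t, 0 < q t) (hqm : Measurable q) (hqi : Integrable q μ) (hq1 : ∫ t, q t ∂μ = 1)
    {g : X → ℝ} (hgm : Measurable g) {B : ℝ} (hgb : ∀ t, |g t| ≤ B)
    (hpos : 0 < ∫ t, g t ^ 2 * w t ∂μ)
    (hs : Summable fun n => (∫ t, g t * ((imhOp μ w q)^[n + 1] g) t * w t ∂μ)
      / ∫ t, g t ^ 2 * w t ∂μ) :
    (∫ t, g t ^ 2 * w t ∂μ) / (B ^ 2 * ∫ z, min (w z.1 * q z.2) (w z.2 * q z.1) ∂(μ.prod μ)) - 1 / 2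
      ≤ tauInt (fun n => (∫ t, g t * ((imhOp μ w q)^[n] g) t * w t ∂μ) / ∫ t, g t ^ 2 * w t ∂μ) := by
  have hrej := imhOp_tauInt_ge_rejection hw0 hwm hwi hq0 hqm hqi hq1 hgm hgb hs
  have hfloor := integral_sq_mul_weight_mul_rejection_ge hw0 hwm hwi hq0 hqm hqi hq1 hgm hgb
  obtain ⟨hlt, -⟩ := imhOp_tauIntWindow_le_tauInt hw0 hwm hwi hq0 hqm hqi hq1 hgm hgb hs 0
  have hrle := rejection_le_autocorr_one hw0 hwm hwi hq0 hqm hqi hq1 hgm hgb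
  set E : ℝ := ∫ t, g t ^ 2 * w t ∂μ with hE
  set A : ℝ := ∫ z, min (w z.1 * q z.2) (w z.2 * q z.1) ∂(μ.prod μ) with hA
  set R : ℝ := ∫ t, g t ^ 2 * w t * (∫ t', (1 - imhAcceptQ w q t t') * q t' ∂μ) ∂μ with hR
  have hx1 : R / E < 1 := lt_of_le_of_lt hrle hlt
  have hx : 1 - R / E ≤ B ^ 2 * A / E := by
    rw [le_div_iff₀ hpos, sub_mul, one_mul, div_mul_cancel₀ _ hpos.ne']
    linarith
  have key := one_div_sub_half_le hx1 hx
  rw [one_div_div] at key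
  exact key.trans hrej

/-- **TWO-SIDED `τ_int` UNDER A WEIGHT BOUND** `w ≤ C·q` (the uniformly ergodic regime): for a bounded measurable
`g` with `∫ g w = 0` and `E = ∫ g² w > 0` the autocorrelation series is summable (row 2) and
`E/(B²A) − ½ ≤ τ_int ≤ C/Z − ½`, `Z = ∫ w`. [ours] -/
theorem imhOp_tauInt_twoSided (hw0 : ∀ t, 0 < w t) (hwm : Measurable w) (hwi : Integrable w μ)
    (hq0 : ∀ t, 0 < q t) (hqm : Measurable q) (hqi : Integrable q μ) (hq1 : ∫ t, q t ∂μ = 1)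
    {C : ℝ} (hC : ∀ t, w t ≤ C * q t) {g : X → ℝ} (hgm : Measurable g) {B : ℝ} (hgb : ∀ t, |g t| ≤ B)
    (hg0 : ∫ t, g t * w t ∂μ = 0) (hpos : 0 < ∫ t, g t ^ 2 * w t ∂μ) :
    (∫ t, g t ^ 2 * w t ∂μ) / (B ^ 2 * ∫ z, min (w z.1 * q z.2) (w z.2 * q z.1) ∂(μ.prod μ)) - 1 / 2
        ≤ tauInt (fun n => (∫ t, g t * ((imhOp μ w q)^[n] g) t * w t ∂μ) / ∫ t, g t ^ 2 * w t ∂μ)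
      ∧ tauInt (fun n => (∫ t, g t * ((imhOp μ w q)^[n] g) t * w t ∂μ) / ∫ t, g t ^ 2 * w t ∂μ)
        ≤ C / (∫ s, w s ∂μ) - 1 / 2 := by
  obtain ⟨hs, -, -, hup⟩ := imhOp_tauInt_sandwich hw0 hwm hwi hq0 hqm hqi hq1 hC hgm hgb hg0
  exact ⟨imhOp_tauInt_ge_invAcceptance hw0 hwm hwi hq0 hqm hqi hq1 hgm hgb hpos hs, hup⟩

end General

/-! ## §2 The Wilson measure, every compact gauge group -/

section Wilson

variable {d L N : ℕ} [NeZero L] {G : Type*} [Group G] [TopologicalSpace G] [IsTopologicalGroup G]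
  [CompactSpace G] [MeasurableSpace G] [BorelSpace G] [SecondCountableTopology G]
  (ρ : G →* Matrix (Fin N) (Fin N) ℂ)

/-- **The stationary acceptance of an exact flow sampler of the Wilson measure is positive** (every measurable
model density `q > 0` with `∫ q dD[U] = 1`). [folklore] -/
theorem wilson_flowAcc_pos (hρ : Continuous ρ) (β : ℝ) {q : GaugeConfig d L G → ℝ}
    (hqm : Measurable q) (hq0 : ∀ U, 0 < q U) (hq1 : ∫ U, q U ∂(trivialMeasure G d L) = 1) :
    0 < ∫ z, min (exp (β * (-wilsonAction ρ z.1)) /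
          mgf (fun U => -wilsonAction ρ U) (trivialMeasure G d L) β * q z.2)
        (exp (β * (-wilsonAction ρ z.2)) /
          mgf (fun U => -wilsonAction ρ U) (trivialMeasure G d L) β * q z.1)
        ∂((trivialMeasure G d L).prod (trivialMeasure G d L)) := by
  haveI : IsProbabilityMeasure (trivialMeasure G d L) := trivialMeasure_isProbabilityMeasure
  set w : GaugeConfig d L G → ℝ := fun U => exp (β * (-wilsonAction ρ U)) /
    mgf (fun U => -wilsonAction ρ U) (trivialMeasure G d L) β with hw
  have hmgf : 0 < mgf (fun U => -wilsonAction ρ U) (trivialMeasure G d L) β :=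
    mgf_pos (integrable_trivialMeasure_of_continuous_group
      (continuous_exp.comp (continuous_const.mul (continuous_wilsonAction_of_continuous ρ hρ).neg)))
  have hw0 : ∀ U, 0 < w U := fun U => div_pos (exp_pos _) hmgf
  have hwc : Continuous w :=
    (continuous_exp.comp (continuous_const.mul (continuous_wilsonAction_of_continuous ρ hρ).neg)).div_const _
  have hwi : Integrable w (trivialMeasure G d L) := integrable_trivialMeasure_of_continuous_group hwc
  exact acceptFlow_pos hw0 hwc.measurable hwi hq0 hqm hq1

/-- **`τ_int(g) ≥ E_β[g²]/(B²·acc) − ½` FOR THE EXACT FLOW SAMPLER OF THE WILSON MEASURE, EVERY COMPACT GAUGE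
GROUP, EVERY COUPLING**: for a measurable model density `q > 0` over `D[U]` with `∫ q dD[U] = 1`, a bounded
measurable observable `g` (`|g| ≤ B`) with `E_{μ_β}[g²] > 0` whose autocorrelation series along the exact chain
(`K = imhOp D[U] p_β q`) is summable: `E_{μ_β}[g²]/(B²·acc) − ½ ≤ τ_int(ρ_g)`,
`acc = ∫∫ min(p_β(U)q(V), p_β(V)q(U)) dD dD` the stationary acceptance. [ours] -/
theorem wilson_flow_tauInt_ge (hρ : Continuous ρ) (β : ℝ) {q : GaugeConfig d L G → ℝ}
    (hqm : Measurable q) (hq0 : ∀ U, 0 < q U) (hq1 : ∫ U, q U ∂(trivialMeasure G d L) = 1)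
    {g : GaugeConfig d L G → ℝ} (hgm : Measurable g) {B : ℝ} (hgb : ∀ U, |g U| ≤ B)
    (hpos : 0 < ∫ U, g U ^ 2 ∂(wilsonMeasure (d := d) (L := L) ρ β))
    (hs : Summable fun n => (∫ U, g U * ((imhOp (trivialMeasure G d L)
        (fun U => exp (β * (-wilsonAction ρ U)) / mgf (fun U => -wilsonAction ρ U) (trivialMeasure G d L) β)
        q)^[n + 1] g) U ∂(wilsonMeasure (d := d) (L := L) ρ β)) /
        ∫ U, g U ^ 2 ∂(wilsonMeasure (d := d) (L := L) ρ β)) :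
    (∫ U, g U ^ 2 ∂(wilsonMeasure (d := d) (L := L) ρ β)) / (B ^ 2 *
        ∫ z, min (exp (β * (-wilsonAction ρ z.1)) /
              mgf (fun U => -wilsonAction ρ U) (trivialMeasure G d L) β * q z.2)
            (exp (β * (-wilsonAction ρ z.2)) /
              mgf (fun U => -wilsonAction ρ U) (trivialMeasure G d L) β * q z.1)
            ∂((trivialMeasure G d L).prod (trivialMeasure G d L))) - 1 / 2 ≤
      tauInt (fun n => (∫ U, g U * ((imhOp (trivialMeasure G d L)
          (fun U => exp (β * (-wilsonAction ρ U)) / mgf (fun U => -wilsonAction ρ U) (trivialMeasure G d L) β)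
          q)^[n] g) U ∂(wilsonMeasure (d := d) (L := L) ρ β)) /
        ∫ U, g U ^ 2 ∂(wilsonMeasure (d := d) (L := L) ρ β)) := by
  haveI : IsProbabilityMeasure (trivialMeasure G d L) := trivialMeasure_isProbabilityMeasure
  set w : GaugeConfig d L G → ℝ := fun U => exp (β * (-wilsonAction ρ U)) /
    mgf (fun U => -wilsonAction ρ U) (trivialMeasure G d L) β with hw
  have hmgf : 0 < mgf (fun U => -wilsonAction ρ U) (trivialMeasure G d L) β :=
    mgf_pos (integrable_trivialMeasure_of_continuous_group
      (continuous_exp.comp (continuous_const.mul (continuous_wilsonAction_of_continuous ρ hρ).neg)))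
  have hw0 : ∀ U, 0 < w U := fun U => div_pos (exp_pos _) hmgf
  have hwc : Continuous w :=
    (continuous_exp.comp (continuous_const.mul (continuous_wilsonAction_of_continuous ρ hρ).neg)).div_const _
  have hwm : Measurable w := hwc.measurable
  have hwi : Integrable w (trivialMeasure G d L) := integrable_trivialMeasure_of_continuous_group hwc
  have hqi : Integrable q (trivialMeasure G d L) :=
    (integrable_and_ne_zero_of_integral_eq_one (μ := trivialMeasure G d L) hq1).1
  have e : (fun n => (∫ U, g U * ((imhOp (trivialMeasure G d L) w q)^[n] g) U * w U ∂(trivialMeasure G d L)) /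
      ∫ U, g U ^ 2 * w U ∂(trivialMeasure G d L)) =
      fun n => (∫ U, g U * ((imhOp (trivialMeasure G d L) w q)^[n] g) U ∂(wilsonMeasure (d := d) (L := L) ρ β)) /
        ∫ U, g U ^ 2 ∂(wilsonMeasure (d := d) (L := L) ρ β) := by
    funext n
    rw [integral_mul_wilsonDensity_eq ρ hρ β, integral_mul_wilsonDensity_eq ρ hρ β]
  have e2 : ∫ U, g U ^ 2 * w U ∂(trivialMeasure G d L) = ∫ U, g U ^ 2 ∂(wilsonMeasure (d := d) (L := L) ρ β) :=
    integral_mul_wilsonDensity_eq ρ hρ β _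
  have hpos' : 0 < ∫ U, g U ^ 2 * w U ∂(trivialMeasure G d L) := by rwa [e2]
  have hs' : Summable fun n => (∫ U, g U * ((imhOp (trivialMeasure G d L) w q)^[n + 1] g) U * w U
      ∂(trivialMeasure G d L)) / ∫ U, g U ^ 2 * w U ∂(trivialMeasure G d L) := by
    have e' : (fun n => (∫ U, g U * ((imhOp (trivialMeasure G d L) w q)^[n + 1] g) U * w U
        ∂(trivialMeasure G d L)) / ∫ U, g U ^ 2 * w U ∂(trivialMeasure G d L)) =
        fun n => (∫ U, g U * ((imhOp (trivialMeasure G d L) w q)^[n + 1] g) U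
          ∂(wilsonMeasure (d := d) (L := L) ρ β)) / ∫ U, g U ^ 2 ∂(wilsonMeasure (d := d) (L := L) ρ β) := by
      funext n
      rw [integral_mul_wilsonDensity_eq ρ hρ β, integral_mul_wilsonDensity_eq ρ hρ β]
    rw [e']
    exact hs
  have h := imhOp_tauInt_ge_invAcceptance hw0 hwm hwi hq0 hqm hqi hq1 hgm hgb hpos' hs'
  rw [e, e2] at h
  exact h

/-- **TWO-SIDED `τ_int` FOR A COVERING MODEL** (every compact `G`, every real `β`): if moreover `p_β ≤ C'·q`
(importance weights `≤ C'`) and `E_{μ_β}[g] = 0`, the series is summable and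
`E_{μ_β}[g²]/(B²·acc) − ½ ≤ τ_int(ρ_g) ≤ C' − ½`. [ours] -/
theorem wilson_flow_tauInt_twoSided (hρ : Continuous ρ) (β : ℝ) {q : GaugeConfig d L G → ℝ}
    (hqm : Measurable q) (hq0 : ∀ U, 0 < q U) (hq1 : ∫ U, q U ∂(trivialMeasure G d L) = 1) {C' : ℝ}
    (hC : ∀ U, exp (β * (-wilsonAction ρ U)) / mgf (fun U => -wilsonAction ρ U) (trivialMeasure G d L) β
      ≤ C' * q U)
    {g : GaugeConfig d L G → ℝ} (hgm : Measurable g) {B : ℝ} (hgb : ∀ U, |g U| ≤ B)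
    (hg0 : ∫ U, g U ∂(wilsonMeasure (d := d) (L := L) ρ β) = 0)
    (hpos : 0 < ∫ U, g U ^ 2 ∂(wilsonMeasure (d := d) (L := L) ρ β)) :
    (∫ U, g U ^ 2 ∂(wilsonMeasure (d := d) (L := L) ρ β)) / (B ^ 2 *
        ∫ z, min (exp (β * (-wilsonAction ρ z.1)) /
              mgf (fun U => -wilsonAction ρ U) (trivialMeasure G d L) β * q z.2)
            (exp (β * (-wilsonAction ρ z.2)) /
              mgf (fun U => -wilsonAction ρ U) (trivialMeasure G d L) β * q z.1)
            ∂((trivialMeasure G d L).prod (trivialMeasure G d L))) - 1 / 2 ≤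
      tauInt (fun n => (∫ U, g U * ((imhOp (trivialMeasure G d L)
          (fun U => exp (β * (-wilsonAction ρ U)) / mgf (fun U => -wilsonAction ρ U) (trivialMeasure G d L) β)
          q)^[n] g) U ∂(wilsonMeasure (d := d) (L := L) ρ β)) /
        ∫ U, g U ^ 2 ∂(wilsonMeasure (d := d) (L := L) ρ β))
    ∧ tauInt (fun n => (∫ U, g U * ((imhOp (trivialMeasure G d L)
          (fun U => exp (β * (-wilsonAction ρ U)) / mgf (fun U => -wilsonAction ρ U) (trivialMeasure G d L) β)
          q)^[n] g) U ∂(wilsonMeasure (d := d) (L := L) ρ β)) /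
        ∫ U, g U ^ 2 ∂(wilsonMeasure (d := d) (L := L) ρ β)) ≤ C' - 1 / 2 := by
  haveI : IsProbabilityMeasure (trivialMeasure G d L) := trivialMeasure_isProbabilityMeasure
  set w : GaugeConfig d L G → ℝ := fun U => exp (β * (-wilsonAction ρ U)) /
    mgf (fun U => -wilsonAction ρ U) (trivialMeasure G d L) β with hw
  have hmgf : 0 < mgf (fun U => -wilsonAction ρ U) (trivialMeasure G d L) β :=
    mgf_pos (integrable_trivialMeasure_of_continuous_group
      (continuous_exp.comp (continuous_const.mul (continuous_wilsonAction_of_continuous ρ hρ).neg)))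
  have hw0 : ∀ U, 0 < w U := fun U => div_pos (exp_pos _) hmgf
  have hwc : Continuous w :=
    (continuous_exp.comp (continuous_const.mul (continuous_wilsonAction_of_continuous ρ hρ).neg)).div_const _
  have hwm : Measurable w := hwc.measurable
  have hwi : Integrable w (trivialMeasure G d L) := integrable_trivialMeasure_of_continuous_group hwc
  have hqi : Integrable q (trivialMeasure G d L) :=
    (integrable_and_ne_zero_of_integral_eq_one (μ := trivialMeasure G d L) hq1).1
  have hg0' : ∫ U, g U * w U ∂(trivialMeasure G d L) = 0 := by
    rw [integral_mul_wilsonDensity_eq ρ hρ β, hg0]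
  obtain ⟨hs, -, -, -⟩ := imhOp_tauInt_sandwich hw0 hwm hwi hq0 hqm hqi hq1 hC hgm hgb hg0'
  have e' : (fun n => (∫ U, g U * ((imhOp (trivialMeasure G d L) w q)^[n + 1] g) U * w U
      ∂(trivialMeasure G d L)) / ∫ U, g U ^ 2 * w U ∂(trivialMeasure G d L)) =
      fun n => (∫ U, g U * ((imhOp (trivialMeasure G d L) w q)^[n + 1] g) U
        ∂(wilsonMeasure (d := d) (L := L) ρ β)) / ∫ U, g U ^ 2 ∂(wilsonMeasure (d := d) (L := L) ρ β) := by
    funext n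
    rw [integral_mul_wilsonDensity_eq ρ hρ β, integral_mul_wilsonDensity_eq ρ hρ β]
  rw [e'] at hs
  exact ⟨wilson_flow_tauInt_ge ρ hρ β hqm hq0 hq1 hgm hgb hpos hs,
    wilson_flow_tauInt_le ρ hρ β hqm hq0 hq1 hC hgm hgb hg0⟩

/-- **EVERY CONTINUOUS FLOW**: for a CONTINUOUS positive model density `q` on the compact configuration space
`G^E` (`∫ q dD[U] = 1`) and a bounded measurable centred observable with `E_{μ_β}[g²] > 0`, the integrated
autocorrelation time of the exact flow sampler satisfies `E_{μ_β}[g²]/(B²·acc) − ½ ≤ τ_int(ρ_g)` with no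
further hypothesis (a covering constant `C' = max p_β/q` exists by compactness). [ours] -/
theorem wilson_flow_tauInt_ge_of_continuous (hρ : Continuous ρ) (β : ℝ) {q : GaugeConfig d L G → ℝ}
    (hqc : Continuous q) (hq0 : ∀ U, 0 < q U) (hq1 : ∫ U, q U ∂(trivialMeasure G d L) = 1)
    {g : GaugeConfig d L G → ℝ} (hgm : Measurable g) {B : ℝ} (hgb : ∀ U, |g U| ≤ B)
    (hg0 : ∫ U, g U ∂(wilsonMeasure (d := d) (L := L) ρ β) = 0)
    (hpos : 0 < ∫ U, g U ^ 2 ∂(wilsonMeasure (d := d) (L := L) ρ β)) :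
    (∫ U, g U ^ 2 ∂(wilsonMeasure (d := d) (L := L) ρ β)) / (B ^ 2 *
        ∫ z, min (exp (β * (-wilsonAction ρ z.1)) /
              mgf (fun U => -wilsonAction ρ U) (trivialMeasure G d L) β * q z.2)
            (exp (β * (-wilsonAction ρ z.2)) /
              mgf (fun U => -wilsonAction ρ U) (trivialMeasure G d L) β * q z.1)
            ∂((trivialMeasure G d L).prod (trivialMeasure G d L))) - 1 / 2 ≤
      tauInt (fun n => (∫ U, g U * ((imhOp (trivialMeasure G d L)
          (fun U => exp (β * (-wilsonAction ρ U)) / mgf (fun U => -wilsonAction ρ U) (trivialMeasure G d L) β)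
          q)^[n] g) U ∂(wilsonMeasure (d := d) (L := L) ρ β)) /
        ∫ U, g U ^ 2 ∂(wilsonMeasure (d := d) (L := L) ρ β)) := by
  -- the ratio `p_β/q` is continuous on the compact space `G^E`, hence bounded by some `C'`
  have hpc : Continuous fun U : GaugeConfig d L G => exp (β * (-wilsonAction ρ U)) /
      mgf (fun U => -wilsonAction ρ U) (trivialMeasure G d L) β :=
    (continuous_exp.comp (continuous_const.mul (continuous_wilsonAction_of_continuous ρ hρ).neg)).div_const _
  have hrc : Continuous fun U : GaugeConfig d L G => (exp (β * (-wilsonAction ρ U)) /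
      mgf (fun U => -wilsonAction ρ U) (trivialMeasure G d L) β) / q U :=
    hpc.div hqc fun U => (hq0 U).ne'
  obtain ⟨C', hC'⟩ := (isCompact_univ.image hrc).isBounded.bddAbove
  have hC : ∀ U, exp (β * (-wilsonAction ρ U)) / mgf (fun U => -wilsonAction ρ U) (trivialMeasure G d L) β
      ≤ C' * q U := fun U => by
    have h : (exp (β * (-wilsonAction ρ U)) /
        mgf (fun U => -wilsonAction ρ U) (trivialMeasure G d L) β) / q U ≤ C' :=
      hC' (Set.mem_image_of_mem _ (Set.mem_univ U))
    rwa [div_le_iff₀ (hq0 U)] at h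
  exact (wilson_flow_tauInt_twoSided ρ hρ β hqc.measurable hq0 hq1 hC hgm hgb hg0 hpos).1

end Wilson

end Summit.Ventures.LatticeQCDFlow.TrivializingMaps

end
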